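import Literature.Analysis.FluidPDE.CollisionalTransferFunctional
import Literature.Analysis.FluidPDE.EmpiricalCollisionMeasureMeasurable
import HarnessLib

/-!
# The collision-indexed transfer functionals are measurable in the initial datum

`Literature.Analysis.FluidPDE.CollisionalTransferFunctional` defines, along a hard-sphere flow
`Φ`, the time-integrated collisional transfer functionals of the initial datum `z` over the
window `(0, h]` with a pair kernel — the collisional momentum transfer
`Φ.collisionalMomentumTransfer φ z h`, the collisional stress `Φ.collisionalStress A z h`, the
collisional virial `Φ.collisionalVirial φ z h` (`d ·` volume `·` time-integrated collisional
pressure) and the collisional energy transfer `Φ.collisionalEnergyTransfer φ z h` (Spohn 1991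
Part I (3.7)–(3.8), (3.15); Soto 2016 §4.8.1) — and `EmpiricalCollisionMeasureMeasurable` proves
that collision sums `z ↦ Σ_{collisions} f(mark)` of a CONTINUOUS function `f` of the collision
mark `(t, x_i, ω, v_i⁻, v_j⁻)` are measurable in `z` (velocity-jump detection, time-slice
measurability of the flow only). This file joins the two: each standard kernel is a continuous
function of the mark, hence **the collisional momentum transfer, stress, virial and energy
transfer along the flow are measurable functions of the initial datum** (extended by `0` off the
good set; a.e.-measurable under every law carried by the good set), for merely continuous test
fields, in every hard-sphere regular measurable geometry (`ℝ^d`; `T^d` with `ε < 1/2`).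

* `collidingPairs_eq_contactPairs` — in a regular geometry the symmetrised colliding pairs of
  `CollisionalTransferFunctional` are the ordered contact pairs of `HardSphereCollisionRecord`;
  `collisionalTransferFunctional_eq_collisionSum` — a pair-kernel functional whose kernel agrees
  on the collisions of the curve with a functional `F` of the collision record IS the collision
  sum `collisionSum … (Ioc a b) F` (curve and flow versions).
* the elastic law read off the mark: at a collision of the ordered pair `(i, j)` of a hard-sphere
  trajectory, with `ω = ε⁻¹ (x_i - x_j)` the recorded impact vector and `(v, w) = (v_i⁻, v_j⁻)` the
  recorded pre-collisional velocities, `v_i⁺ - v_i⁻ = -⟪v - w, ω⟫ ω`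
  (`IsHardSphereTrajectory.vel_sub_leftLim_eq_neg_inner_smul_impactVec`) and
  `x_i - x_j = ε ω` (`sepVec_eq_smul_impactVec`) — polynomial, hence CONTINUOUS, expressions in the
  mark (unlike `reflectVel`, which is discontinuous at `ω = 0`), agreeing with the kernels on
  actual collisions, where `‖ω‖ = 1`.
* `IsHardSphereTrajectory.collisionalMomentumTransfer_eq_collisionSum`, `…Stress…`, `…Virial…`,
  `…EnergyTransfer…` — the four functionals as collision sums of explicit continuous mark
  functions; `HardSphereFlow.measurable_indicator_collisionalMomentumTransfer`, `…Stress`,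
  `…Virial`, `…EnergyTransfer` (+ `aemeasurable_…` under `μ Φ.goodᶜ = 0`) — measurability in the
  datum; and, through `collisionalMomentumTransfer_eq_momentumTransfer` /
  `collisionalEnergyTransfer_eq_energyTransfer`, the same for the jump forms
  `HardSphereFlow.momentumTransfer` / `energyTransfer` of `CollisionalTransfer` with continuous
  test fields (`measurable_indicator_momentumTransfer`, `measurable_indicator_energyTransfer`).
* torus specialisations (`ε < 1/2`, continuous fields, no other side condition):
  `HardSphereFlow.measurable_indicator_collisionalVirial_torus`, `…_momentumTransfer_torus'`, … .

## Mathlib / Literature reuse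

`Finset.sum_congr`, `finsum_mem_congr`, `Set.indicator_congr`, `Measurable.inner`,
`Continuous.inner`, `real_inner_smul_left/right` are Mathlib's. The measurability engine is
`HardSphereFlow.measurable_indicator_collisionSum_Ioc` (`EmpiricalCollisionMeasureMeasurable`);
records, marks and contact pairs are `HardSphereCollisionRecord` (`ofConfig`, `mark`,
`contactPairs`, `IsHardSphereTrajectory.ofConfig_preVel_eq_leftLim`); the jump law
`IsHardSphereTrajectory.vel_sub_leftLim_eq_smul` and the functionals are
`CollisionalTransferFunctional`. Nothing is (re)defined here.

## Design choices

* No new definitions: the mark functions of the four kernels are written as explicit lambdas on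
  `ℝ × X × ℝ^d × ℝ^d × ℝ^d` inside the identification lemmas; users only ever see the
  measurability statements about the named functionals.
* Test fields are assumed continuous AND measurable on the abstract position space `X` (as in
  `EmpiricalCollisionMeasureMeasurable`); on `T^d` the second follows from the first.
* The companion file `CollisionalTransferMeasurable` treats the jump-form transfer of a general
  observable with a streaming derivative through the balance law (no regularity of the geometry,
  no bound on `ε`, but `C¹` fields); here the fields are merely continuous and the functionals need
  not be jumps of an observable (stress, virial), at the price of a regular geometry.

## References

* H. Spohn, *Large Scale Dynamics of Interacting Particles*, Springer (1991), Part I §3.2,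
  (3.7)–(3.8) p. 35, (3.15) p. 36.
* R. Soto, *Kinetic Theory and Transport Phenomena*, OUP (2016), §4.8.1.
* I. Gallagher, L. Saint-Raymond, B. Texier, *From Newton to Boltzmann* (2013), §4.1 (collision
  marks of the hard-sphere flow).
-/

open Set Filter Function
open _root_.MeasureTheory _root_.Topology
open scoped InnerProductSpace

namespace Literature.Analysis.FluidPDE

noncomputable section

section Kinetic

variable {d : Type*} [Fintype d] {X : Type*} {N : ℕ}

/-! ## Colliding pairs are the ordered contact pairs -/

/-- Every ordered contact pair is a colliding pair (the latter are symmetrised). [folklore] -/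
theorem contactPairs_subset_collidingPairs (G : Geometry d X) (ε : ℝ) (z : Config N d X) :
    contactPairs G ε z ⊆ collidingPairs G ε z := fun p hp => by
  obtain ⟨hne, hc⟩ := mem_contactPairs.1 hp
  exact mem_collidingPairs.2 ⟨hne, Or.inl hc⟩

/-- In a hard-sphere regular geometry (contact is symmetric in the pair) the colliding pairs of
`CollisionalTransferFunctional` are exactly the ordered contact pairs of
`HardSphereCollisionRecord`. [folklore] -/
theorem collidingPairs_eq_contactPairs [TopologicalSpace X] {G : Geometry d X} {ε : ℝ}
    (hG : G.IsHardSphereRegular ε) (z : Config N d X) :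
    collidingPairs G ε z = contactPairs G ε z := by
  refine Finset.Subset.antisymm (fun p hp => ?_) (contactPairs_subset_collidingPairs G ε z)
  obtain ⟨hne, hc | hc⟩ := mem_collidingPairs.1 hp
  · exact mem_contactPairs.2 ⟨hne, hc⟩
  · exact mem_contactPairs.2 ⟨hne, hG.mem_contactSet_comm.2 hc⟩

/-! ## Pair-kernel functionals as collision sums over records -/

section Representation

variable [TopologicalSpace X] {G : Geometry d X} {ε : ℝ} {E : Type*} [AddCommMonoid E]

/-- **A pair-kernel functional is a collision sum over records**: in a regular geometry, if the
kernel `g i j (γ t⁻) (γ t)` agrees with `F (record of (t, i, j))` at every ordered contact pair of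
every collision time of the curve `γ` in `(a, b]`, then
`collisionalTransferFunctional G ε g γ a b = collisionSum G ε γ (Ioc a b) F`. [folklore] -/
theorem collisionalTransferFunctional_eq_collisionSum (hG : G.IsHardSphereRegular ε)
    {g : Fin N → Fin N → Config N d X → Config N d X → E}
    {F : HardSphereCollisionRecord d X N → E} {γ : ℝ → Config N d X} {a b : ℝ}
    (hgF : ∀ t ∈ collisionTimes G ε γ ∩ Ioc a b, ∀ p ∈ contactPairs G ε (γ t),
      g p.1 p.2 (Function.leftLim γ t) (γ t) =
        F (HardSphereCollisionRecord.ofConfig G ε (γ t) t p.1 p.2)) :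
    collisionalTransferFunctional G ε g γ a b = collisionSum G ε γ (Ioc a b) F := by
  rw [collisionalTransferFunctional, collisionSum_eq_collisionPairSum, collisionPairSum]
  refine finsum_mem_congr rfl fun t ht => ?_
  rw [collidingPairs_eq_contactPairs hG]
  exact Finset.sum_congr rfl (hgF t ht)

/-- Flow version: along the orbit of `z`, a pair-kernel functional whose kernel agrees with `F`
on the collisions of the orbit in `(0, h]` is the collision sum `Φ.collisionSum (Ioc 0 h) F z`.
[folklore] -/
theorem HardSphereFlow.collisionalTransferFunctional_eq_collisionSum [MeasureSpace X]
    (Φ : HardSphereFlow G ε N) (hG : G.IsHardSphereRegular ε)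
    {g : Fin N → Fin N → Config N d X → Config N d X → E}
    {F : HardSphereCollisionRecord d X N → E} {z : Config N d X} {h : ℝ}
    (hgF : ∀ t ∈ collisionTimes G ε (fun s => Φ.flow s z) ∩ Ioc 0 h,
      ∀ p ∈ contactPairs G ε (Φ.flow t z),
        g p.1 p.2 (Function.leftLim (fun s => Φ.flow s z) t) (Φ.flow t z) =
          F (HardSphereCollisionRecord.ofConfig G ε (Φ.flow t z) t p.1 p.2)) :
    Φ.collisionalTransferFunctional g z h = Φ.collisionSum (Ioc 0 h) F z :=
  FluidPDE.collisionalTransferFunctional_eq_collisionSum hG hgF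

end Representation

/-! ## The elastic law read off the collision mark -/

section MarkLaw

variable [TopologicalSpace X] {G : Geometry d X} {ε : ℝ} {γ : ℝ → Config N d X}

omit [TopologicalSpace X] in
/-- A vector of norm `ε` is `ε` times its `ε⁻¹`-multiple (also when `ε = 0`, both sides being
`0`): at contact, `x_i - x_j = ε ω` with `ω = ε⁻¹ (x_i - x_j)` the impact vector. [folklore] -/
theorem eq_smul_inv_smul_of_norm_eq {n : EuclideanSpace ℝ d} (hn : ‖n‖ = ε) :
    n = ε • ε⁻¹ • n := by
  rcases eq_or_ne ε 0 with rfl | hε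
  · have : n = 0 := norm_eq_zero.1 hn
    simp [this]
  · rw [smul_smul, mul_inv_cancel₀ hε, one_smul]

omit [TopologicalSpace X] in
/-- The elastic velocity jump `-(⟪u, n⟫/|n|²) n` of a pair with separation vector `n` of norm
`ε` and relative pre-collisional velocity `u`, rewritten with the impact vector `ω = ε⁻¹ n`:
`-(⟪u, ω⟫ ω)` (both sides `0` when `ε = 0`). [folklore] -/
theorem neg_inner_div_norm_sq_smul_eq_of_norm_eq {n : EuclideanSpace ℝ d} (hn : ‖n‖ = ε)
    (u : EuclideanSpace ℝ d) :
    -(⟪u, n⟫_ℝ / ‖n‖ ^ 2) • n = -(⟪u, ε⁻¹ • n⟫_ℝ • ε⁻¹ • n) := by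
  rcases eq_or_ne ε 0 with rfl | hε
  · have h0 : n = 0 := norm_eq_zero.1 hn
    simp [h0]
  · rw [real_inner_smul_right, smul_smul, hn, neg_smul]
    congr 2
    field_simp

omit [TopologicalSpace X] in
/-- At an ordered contact pair `(i, j)`: `x_i - x_j = ε ω` with `ω` the recorded impact vector.
[folklore] -/
theorem sepVec_eq_smul_impactVec {z : Config N d X} {t : ℝ} {i j : Fin N}
    (hp : (i, j) ∈ contactPairs G ε z) :
    G.sepVec (z i).1 (z j).1 = ε • (HardSphereCollisionRecord.ofConfig G ε z t i j).impactVec := by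
  rw [HardSphereCollisionRecord.ofConfig_impactVec]
  exact eq_smul_inv_smul_of_norm_eq (mem_contactSet.1 (mem_contactPairs.1 hp).2).2

namespace IsHardSphereTrajectory

/-- **The velocity jump read off the mark.** At a collision of the ordered pair `(i, j)` of a
hard-sphere trajectory (Hausdorff positions, regular geometry), with `ω` the recorded impact
vector and `(v, w)` the recorded pre-collisional velocities,
`v_i(t⁺) - v_i(t⁻) = -⟪v - w, ω⟫ ω` — the elastic law `Δv_i = -(⟪v_i⁻ - v_j⁻, n⟫/|n|²) n`,
`n = x_i - x_j = ε ω`, rewritten as a polynomial (continuous) function of the mark. [folklore] -/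
theorem vel_sub_leftLim_eq_neg_inner_smul_impactVec [T2Space X] (h : IsHardSphereTrajectory G ε N γ)
    (hG : G.IsHardSphereRegular ε) {t : ℝ} {i j : Fin N} (hp : (i, j) ∈ contactPairs G ε (γ t)) :
    (γ t i).2 - (Function.leftLim γ t i).2 =
      -(⟪(HardSphereCollisionRecord.ofConfig G ε (γ t) t i j).preVel.1 -
          (HardSphereCollisionRecord.ofConfig G ε (γ t) t i j).preVel.2,
          (HardSphereCollisionRecord.ofConfig G ε (γ t) t i j).impactVec⟫_ℝ •
        (HardSphereCollisionRecord.ofConfig G ε (γ t) t i j).impactVec) := by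
  have hij : i ≠ j := (mem_contactPairs.1 hp).1
  have hc : γ t ∈ contactSet G N ε i j := (mem_contactPairs.1 hp).2
  have hn : ‖G.sepVec (γ t i).1 (γ t j).1‖ = ε := (mem_contactSet.1 hc).2
  rw [h.ofConfig_preVel_eq_leftLim hp, HardSphereCollisionRecord.ofConfig_impactVec,
    h.vel_sub_leftLim_eq_smul hG.continuous_translate_left hij hc]
  exact neg_inner_div_norm_sq_smul_eq_of_norm_eq hn _

/-- The post-collisional velocity of the first particle read off the mark:
`v_i(t⁺) = v - ⟪v - w, ω⟫ ω`. [folklore] -/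
theorem vel_eq_preVel_sub_inner_smul_impactVec [T2Space X] (h : IsHardSphereTrajectory G ε N γ)
    (hG : G.IsHardSphereRegular ε) {t : ℝ} {i j : Fin N} (hp : (i, j) ∈ contactPairs G ε (γ t)) :
    (γ t i).2 =
      (HardSphereCollisionRecord.ofConfig G ε (γ t) t i j).preVel.1 -
        ⟪(HardSphereCollisionRecord.ofConfig G ε (γ t) t i j).preVel.1 -
            (HardSphereCollisionRecord.ofConfig G ε (γ t) t i j).preVel.2,
            (HardSphereCollisionRecord.ofConfig G ε (γ t) t i j).impactVec⟫_ℝ •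
          (HardSphereCollisionRecord.ofConfig G ε (γ t) t i j).impactVec := by
  have e := h.vel_sub_leftLim_eq_neg_inner_smul_impactVec hG hp
  have hpre : (HardSphereCollisionRecord.ofConfig G ε (γ t) t i j).preVel.1 =
      (Function.leftLim γ t i).2 := by
    rw [h.ofConfig_preVel_eq_leftLim hp]
  rw [hpre] at e ⊢
  rw [sub_eq_iff_eq_add'] at e
  rw [e, ← sub_eq_add_neg]

end IsHardSphereTrajectory

end MarkLaw

/-! ## The four standard functionals as collision sums of continuous mark functions -/

section Instances

variable [TopologicalSpace X] {G : Geometry d X} {ε : ℝ} {γ : ℝ → Config N d X}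

namespace IsHardSphereTrajectory

/-- **The collisional momentum transfer as a collision sum**: with the mark function
`(t, x, ω, v, w) ↦ ⟪φ x, -⟪v - w, ω⟫ ω⟫` (momentum received by the first particle of the
ordered pair, tested at its position). [folklore] -/
theorem collisionalMomentumTransfer_eq_collisionSum [T2Space X] (h : IsHardSphereTrajectory G ε N γ)
    (hG : G.IsHardSphereRegular ε) (φ : X → EuclideanSpace ℝ d) (a b : ℝ) :
    collisionalMomentumTransfer G ε φ γ a b = collisionSum G ε γ (Ioc a b) fun c =>
      (fun m : ℝ × X × EuclideanSpace ℝ d × EuclideanSpace ℝ d × EuclideanSpace ℝ d =>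
        ⟪φ m.2.1, -(⟪m.2.2.2.1 - m.2.2.2.2, m.2.2.1⟫_ℝ • m.2.2.1)⟫_ℝ) c.mark := by
  refine collisionalTransferFunctional_eq_collisionSum hG fun t _ p hp => ?_
  simp only [momentumKernel_apply, HardSphereCollisionRecord.mark_def,
    HardSphereCollisionRecord.ofConfig_fstPos]
  rw [h.vel_sub_leftLim_eq_neg_inner_smul_impactVec hG hp]

/-- **The collisional stress as a collision sum**: with the mark function
`(t, x, ω, v, w) ↦ ½ ⟪A x (ε ω), -⟪v - w, ω⟫ ω⟫` (the tensor `Δv_i ⊗ (x_i - x_j)`,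
`x_i - x_j = ε ω`, contracted with `A(x_i)`). [folklore] -/
theorem collisionalStress_eq_collisionSum [T2Space X] (h : IsHardSphereTrajectory G ε N γ)
    (hG : G.IsHardSphereRegular ε) (A : X → EuclideanSpace ℝ d →L[ℝ] EuclideanSpace ℝ d)
    (a b : ℝ) :
    collisionalStress G ε A γ a b = collisionSum G ε γ (Ioc a b) fun c =>
      (fun m : ℝ × X × EuclideanSpace ℝ d × EuclideanSpace ℝ d × EuclideanSpace ℝ d =>
        2⁻¹ * ⟪A m.2.1 (ε • m.2.2.1), -(⟪m.2.2.2.1 - m.2.2.2.2, m.2.2.1⟫_ℝ • m.2.2.1)⟫_ℝ) c.mark := by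
  refine collisionalTransferFunctional_eq_collisionSum hG fun t _ p hp => ?_
  simp only [stressKernel_apply, HardSphereCollisionRecord.mark_def,
    HardSphereCollisionRecord.ofConfig_fstPos]
  rw [h.vel_sub_leftLim_eq_neg_inner_smul_impactVec hG hp, ← sepVec_eq_smul_impactVec hp]

/-- **The collisional virial as a collision sum**: with the mark function
`(t, x, ω, v, w) ↦ ½ φ x ⟪ε ω, -⟪v - w, ω⟫ ω⟫` (`= -½ ε φ(x) ⟪v - w, ω⟫` on unit `ω`: the normal
momentum transfer, positive on incoming pairs). [folklore] -/
theorem collisionalVirial_eq_collisionSum [T2Space X] (h : IsHardSphereTrajectory G ε N γ)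
    (hG : G.IsHardSphereRegular ε) (φ : X → ℝ) (a b : ℝ) :
    collisionalVirial G ε φ γ a b = collisionSum G ε γ (Ioc a b) fun c =>
      (fun m : ℝ × X × EuclideanSpace ℝ d × EuclideanSpace ℝ d × EuclideanSpace ℝ d =>
        2⁻¹ * (φ m.2.1 * ⟪ε • m.2.2.1, -(⟪m.2.2.2.1 - m.2.2.2.2, m.2.2.1⟫_ℝ • m.2.2.1)⟫_ℝ)) c.mark := by
  refine collisionalTransferFunctional_eq_collisionSum hG fun t _ p hp => ?_
  simp only [virialKernel_apply, HardSphereCollisionRecord.mark_def,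
    HardSphereCollisionRecord.ofConfig_fstPos]
  rw [h.vel_sub_leftLim_eq_neg_inner_smul_impactVec hG hp, ← sepVec_eq_smul_impactVec hp]

/-- **The collisional energy transfer as a collision sum**: with the mark function
`(t, x, ω, v, w) ↦ φ x (‖v - ⟪v - w, ω⟫ ω‖² - ‖v‖²)/2` (kinetic energy received by the first
particle, `v_i⁺ = v - ⟪v - w, ω⟫ ω`). [folklore] -/
theorem collisionalEnergyTransfer_eq_collisionSum [T2Space X] (h : IsHardSphereTrajectory G ε N γ)
    (hG : G.IsHardSphereRegular ε) (φ : X → ℝ) (a b : ℝ) :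
    collisionalEnergyTransfer G ε φ γ a b = collisionSum G ε γ (Ioc a b) fun c =>
      (fun m : ℝ × X × EuclideanSpace ℝ d × EuclideanSpace ℝ d × EuclideanSpace ℝ d =>
        φ m.2.1 * ((‖m.2.2.2.1 - ⟪m.2.2.2.1 - m.2.2.2.2, m.2.2.1⟫_ℝ • m.2.2.1‖ ^ 2 -
          ‖m.2.2.2.1‖ ^ 2) / 2)) c.mark := by
  refine collisionalTransferFunctional_eq_collisionSum hG fun t _ p hp => ?_
  simp only [energyKernel_apply, HardSphereCollisionRecord.mark_def,
    HardSphereCollisionRecord.ofConfig_fstPos]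
  rw [← h.vel_eq_preVel_sub_inner_smul_impactVec hG hp, h.ofConfig_preVel_eq_leftLim hp]

end IsHardSphereTrajectory

/-! ### Continuity and measurability of the mark functions -/

/-- The jump map `(t, x, ω, v, w) ↦ -⟪v - w, ω⟫ ω` is continuous in the mark. [folklore] -/
theorem continuous_markJump :
    Continuous fun m : ℝ × X × EuclideanSpace ℝ d × EuclideanSpace ℝ d × EuclideanSpace ℝ d =>
      -(⟪m.2.2.2.1 - m.2.2.2.2, m.2.2.1⟫_ℝ • m.2.2.1) := by
  fun_prop

omit [TopologicalSpace X] in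
/-- The jump map `(t, x, ω, v, w) ↦ -⟪v - w, ω⟫ ω` is measurable in the mark. [folklore] -/
theorem measurable_markJump [MeasurableSpace X] :
    Measurable fun m : ℝ × X × EuclideanSpace ℝ d × EuclideanSpace ℝ d × EuclideanSpace ℝ d =>
      -(⟪m.2.2.2.1 - m.2.2.2.2, m.2.2.1⟫_ℝ • m.2.2.1) := by
  have hω : Measurable fun m : ℝ × X × EuclideanSpace ℝ d × EuclideanSpace ℝ d ×
      EuclideanSpace ℝ d => m.2.2.1 := measurable_snd.snd.fst
  have hv : Measurable fun m : ℝ × X × EuclideanSpace ℝ d × EuclideanSpace ℝ d ×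
      EuclideanSpace ℝ d => m.2.2.2.1 := measurable_snd.snd.snd.fst
  have hw : Measurable fun m : ℝ × X × EuclideanSpace ℝ d × EuclideanSpace ℝ d ×
      EuclideanSpace ℝ d => m.2.2.2.2 := measurable_snd.snd.snd.snd
  have hin : Measurable fun m : ℝ × X × EuclideanSpace ℝ d × EuclideanSpace ℝ d ×
      EuclideanSpace ℝ d => ⟪m.2.2.2.1 - m.2.2.2.2, m.2.2.1⟫_ℝ := (hv.sub hw).inner hω
  exact (hin.smul hω).neg

/-- The post-collisional velocity map `(t, x, ω, v, w) ↦ v - ⟪v - w, ω⟫ ω` is continuous in the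
mark. [folklore] -/
theorem continuous_markPostVel :
    Continuous fun m : ℝ × X × EuclideanSpace ℝ d × EuclideanSpace ℝ d × EuclideanSpace ℝ d =>
      m.2.2.2.1 - ⟪m.2.2.2.1 - m.2.2.2.2, m.2.2.1⟫_ℝ • m.2.2.1 := by
  fun_prop

omit [TopologicalSpace X] in
/-- The post-collisional velocity map `(t, x, ω, v, w) ↦ v - ⟪v - w, ω⟫ ω` is measurable in the
mark. [folklore] -/
theorem measurable_markPostVel [MeasurableSpace X] :
    Measurable fun m : ℝ × X × EuclideanSpace ℝ d × EuclideanSpace ℝ d × EuclideanSpace ℝ d =>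
      m.2.2.2.1 - ⟪m.2.2.2.1 - m.2.2.2.2, m.2.2.1⟫_ℝ • m.2.2.1 := by
  have hω : Measurable fun m : ℝ × X × EuclideanSpace ℝ d × EuclideanSpace ℝ d ×
      EuclideanSpace ℝ d => m.2.2.1 := measurable_snd.snd.fst
  have hv : Measurable fun m : ℝ × X × EuclideanSpace ℝ d × EuclideanSpace ℝ d ×
      EuclideanSpace ℝ d => m.2.2.2.1 := measurable_snd.snd.snd.fst
  have hw : Measurable fun m : ℝ × X × EuclideanSpace ℝ d × EuclideanSpace ℝ d ×
      EuclideanSpace ℝ d => m.2.2.2.2 := measurable_snd.snd.snd.snd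
  have hin : Measurable fun m : ℝ × X × EuclideanSpace ℝ d × EuclideanSpace ℝ d ×
      EuclideanSpace ℝ d => ⟪m.2.2.2.1 - m.2.2.2.2, m.2.2.1⟫_ℝ := (hv.sub hw).inner hω
  exact hv.sub (hin.smul hω)

end Instances

/-! ## Measurability in the initial datum along a hard-sphere flow -/

section Flow

variable [MeasureSpace X] [TopologicalSpace X] {G : Geometry d X} {ε : ℝ}

namespace HardSphereFlow

variable (Φ : HardSphereFlow G ε N)

/-- Transport of measurability through an identification valid on the good set: if on the good
set `W z = Φ.collisionSum (Ioc 0 h) (f ∘ mark) z` for a continuous and measurable mark function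
`f`, then `W`, extended by `0` off the good set, is measurable (regular measurable geometry).
[folklore] -/
theorem measurable_indicator_of_eqOn_collisionSum {E : Type*} [AddCommMonoid E]
    [MeasurableSpace E] [TopologicalSpace E] [ContinuousAdd E]
    [TopologicalSpace.PseudoMetrizableSpace E] [BorelSpace E] [MeasurableAdd₂ E]
    (hG : G.IsHardSphereRegular ε) (hGm : G.IsMeasurable)
    {f : ℝ × X × EuclideanSpace ℝ d × EuclideanSpace ℝ d × EuclideanSpace ℝ d → E}
    (hfc : Continuous f) (hfm : Measurable f) {W : Config N d X → E} (h : ℝ)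
    (hW : ∀ z ∈ Φ.good, W z = Φ.collisionSum (Ioc 0 h) (fun c => f c.mark) z) :
    Measurable (Φ.good.indicator W) := by
  rw [indicator_congr fun z hz => hW z hz]
  exact Φ.measurable_indicator_collisionSum_Ioc hG hGm hfc hfm 0 h

/-- **Measurability of the collisional momentum transfer in the datum**: for a continuous and
measurable vector test field `φ`, `z ↦ Φ.collisionalMomentumTransfer φ z h`, extended by `0` off
the good set, is measurable (regular measurable geometry). [folklore] -/
theorem measurable_indicator_collisionalMomentumTransfer [T2Space X]
    (hG : G.IsHardSphereRegular ε) (hGm : G.IsMeasurable) {φ : X → EuclideanSpace ℝ d}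
    (hφc : Continuous φ) (hφm : Measurable φ) (h : ℝ) :
    Measurable (Φ.good.indicator fun z => Φ.collisionalMomentumTransfer φ z h) := by
  refine Φ.measurable_indicator_of_eqOn_collisionSum hG hGm
    (f := fun m : ℝ × X × EuclideanSpace ℝ d × EuclideanSpace ℝ d × EuclideanSpace ℝ d =>
      ⟪φ m.2.1, -(⟪m.2.2.2.1 - m.2.2.2.2, m.2.2.1⟫_ℝ • m.2.2.1)⟫_ℝ) ?_ ?_ h fun z hz => ?_
  · exact (hφc.comp (by fun_prop)).inner continuous_markJump
  · have hφ' : Measurable fun m : ℝ × X × EuclideanSpace ℝ d × EuclideanSpace ℝ d ×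
        EuclideanSpace ℝ d => φ m.2.1 := hφm.comp measurable_snd.fst
    exact hφ'.inner measurable_markJump
  · exact (Φ.isTrajectory z hz).collisionalMomentumTransfer_eq_collisionSum hG φ 0 h

/-- **Measurability of the collisional stress in the datum**: for a matrix test field `A` that
is continuous and measurable as a map into continuous linear maps,
`z ↦ Φ.collisionalStress A z h`, extended by `0` off the good set, is measurable. [folklore] -/
theorem measurable_indicator_collisionalStress [T2Space X] (hG : G.IsHardSphereRegular ε)
    (hGm : G.IsMeasurable) {A : X → EuclideanSpace ℝ d →L[ℝ] EuclideanSpace ℝ d}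
    (hAc : Continuous A) (hAm : Measurable A) (h : ℝ) :
    Measurable (Φ.good.indicator fun z => Φ.collisionalStress A z h) := by
  refine Φ.measurable_indicator_of_eqOn_collisionSum hG hGm
    (f := fun m : ℝ × X × EuclideanSpace ℝ d × EuclideanSpace ℝ d × EuclideanSpace ℝ d =>
      2⁻¹ * ⟪A m.2.1 (ε • m.2.2.1), -(⟪m.2.2.2.1 - m.2.2.2.2, m.2.2.1⟫_ℝ • m.2.2.1)⟫_ℝ)
    ?_ ?_ h fun z hz => ?_
  · refine continuous_const.mul (Continuous.inner ?_ continuous_markJump)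
    exact (hAc.comp (by fun_prop)).clm_apply (by fun_prop)
  · have hA' : Measurable fun m : ℝ × X × EuclideanSpace ℝ d × EuclideanSpace ℝ d ×
        EuclideanSpace ℝ d => A m.2.1 := hAm.comp measurable_snd.fst
    have hω : Measurable fun m : ℝ × X × EuclideanSpace ℝ d × EuclideanSpace ℝ d ×
        EuclideanSpace ℝ d => ε • m.2.2.1 := measurable_snd.snd.fst.const_smul ε
    have hev : Continuous fun p : (EuclideanSpace ℝ d →L[ℝ] EuclideanSpace ℝ d) ×
        EuclideanSpace ℝ d => p.1 p.2 := isBoundedBilinearMap_apply.continuous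
    have hAω : Measurable fun m : ℝ × X × EuclideanSpace ℝ d × EuclideanSpace ℝ d ×
        EuclideanSpace ℝ d => A m.2.1 (ε • m.2.2.1) := hev.measurable.comp (hA'.prodMk hω)
    exact measurable_const.mul (hAω.inner measurable_markJump)
  · exact (Φ.isTrajectory z hz).collisionalStress_eq_collisionSum hG A 0 h

/-- **Measurability of the collisional virial in the datum** (`d ·` volume `·` the
time-integrated collisional pressure for `φ ≡ 1`): for a continuous and measurable scalar test
field `φ`, `z ↦ Φ.collisionalVirial φ z h`, extended by `0` off the good set, is measurable.
[folklore] -/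
theorem measurable_indicator_collisionalVirial [T2Space X] (hG : G.IsHardSphereRegular ε)
    (hGm : G.IsMeasurable) {φ : X → ℝ} (hφc : Continuous φ) (hφm : Measurable φ) (h : ℝ) :
    Measurable (Φ.good.indicator fun z => Φ.collisionalVirial φ z h) := by
  refine Φ.measurable_indicator_of_eqOn_collisionSum hG hGm
    (f := fun m : ℝ × X × EuclideanSpace ℝ d × EuclideanSpace ℝ d × EuclideanSpace ℝ d =>
      2⁻¹ * (φ m.2.1 * ⟪ε • m.2.2.1, -(⟪m.2.2.2.1 - m.2.2.2.2, m.2.2.1⟫_ℝ • m.2.2.1)⟫_ℝ))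
    ?_ ?_ h fun z hz => ?_
  · exact continuous_const.mul ((hφc.comp (by fun_prop)).mul
      (Continuous.inner (by fun_prop) continuous_markJump))
  · have hφ' : Measurable fun m : ℝ × X × EuclideanSpace ℝ d × EuclideanSpace ℝ d ×
        EuclideanSpace ℝ d => φ m.2.1 := hφm.comp measurable_snd.fst
    have hω : Measurable fun m : ℝ × X × EuclideanSpace ℝ d × EuclideanSpace ℝ d ×
        EuclideanSpace ℝ d => ε • m.2.2.1 := measurable_snd.snd.fst.const_smul ε
    have hin : Measurable fun m : ℝ × X × EuclideanSpace ℝ d × EuclideanSpace ℝ d ×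
        EuclideanSpace ℝ d => ⟪ε • m.2.2.1, -(⟪m.2.2.2.1 - m.2.2.2.2, m.2.2.1⟫_ℝ • m.2.2.1)⟫_ℝ :=
      hω.inner measurable_markJump
    exact measurable_const.mul (hφ'.mul hin)
  · exact (Φ.isTrajectory z hz).collisionalVirial_eq_collisionSum hG φ 0 h

/-- **Measurability of the collisional energy transfer in the datum**: for a continuous and
measurable scalar test field `φ`, `z ↦ Φ.collisionalEnergyTransfer φ z h`, extended by `0` off
the good set, is measurable. [folklore] -/
theorem measurable_indicator_collisionalEnergyTransfer [T2Space X] (hG : G.IsHardSphereRegular ε)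
    (hGm : G.IsMeasurable) {φ : X → ℝ} (hφc : Continuous φ) (hφm : Measurable φ) (h : ℝ) :
    Measurable (Φ.good.indicator fun z => Φ.collisionalEnergyTransfer φ z h) := by
  refine Φ.measurable_indicator_of_eqOn_collisionSum hG hGm
    (f := fun m : ℝ × X × EuclideanSpace ℝ d × EuclideanSpace ℝ d × EuclideanSpace ℝ d =>
      φ m.2.1 * ((‖m.2.2.2.1 - ⟪m.2.2.2.1 - m.2.2.2.2, m.2.2.1⟫_ℝ • m.2.2.1‖ ^ 2 -
        ‖m.2.2.2.1‖ ^ 2) / 2)) ?_ ?_ h fun z hz => ?_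
  · have hx : Continuous fun m : ℝ × X × EuclideanSpace ℝ d × EuclideanSpace ℝ d ×
        EuclideanSpace ℝ d => φ m.2.1 := hφc.comp (by fun_prop)
    have hv : Continuous fun m : ℝ × X × EuclideanSpace ℝ d × EuclideanSpace ℝ d ×
        EuclideanSpace ℝ d => m.2.2.2.1 := by fun_prop
    exact hx.mul (((continuous_markPostVel.norm.pow 2).sub (hv.norm.pow 2)).div_const 2)
  · have hx : Measurable fun m : ℝ × X × EuclideanSpace ℝ d × EuclideanSpace ℝ d ×
        EuclideanSpace ℝ d => φ m.2.1 := hφm.comp measurable_snd.fst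
    have hv : Measurable fun m : ℝ × X × EuclideanSpace ℝ d × EuclideanSpace ℝ d ×
        EuclideanSpace ℝ d => m.2.2.2.1 := measurable_snd.snd.snd.fst
    exact hx.mul (((measurable_markPostVel.norm.pow_const 2).sub (hv.norm.pow_const 2)).div_const 2)
  · exact (Φ.isTrajectory z hz).collisionalEnergyTransfer_eq_collisionSum hG φ 0 h

/-- **Measurability of the jump-form momentum transfer** `HardSphereFlow.momentumTransfer` of
`CollisionalTransfer` for a continuous (and measurable) test field: it agrees with the
collision-indexed form on the good set. [folklore] -/
theorem measurable_indicator_momentumTransfer [T2Space X] (hG : G.IsHardSphereRegular ε)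
    (hGm : G.IsMeasurable) {φ : X → EuclideanSpace ℝ d} (hφc : Continuous φ) (hφm : Measurable φ)
    (h : ℝ) : Measurable (Φ.good.indicator fun z => Φ.momentumTransfer φ z h) := by
  rw [← indicator_congr fun z hz =>
    Φ.collisionalMomentumTransfer_eq_momentumTransfer hG.continuous_translate_left φ hz h]
  exact Φ.measurable_indicator_collisionalMomentumTransfer hG hGm hφc hφm h

/-- **Measurability of the jump-form energy transfer** `HardSphereFlow.energyTransfer` of
`CollisionalTransfer` for a continuous (and measurable) test field. [folklore] -/
theorem measurable_indicator_energyTransfer [T2Space X] (hG : G.IsHardSphereRegular ε)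
    (hGm : G.IsMeasurable) {φ : X → ℝ} (hφc : Continuous φ) (hφm : Measurable φ) (h : ℝ) :
    Measurable (Φ.good.indicator fun z => Φ.energyTransfer φ z h) := by
  rw [← indicator_congr fun z hz =>
    Φ.collisionalEnergyTransfer_eq_energyTransfer hG.continuous_translate_left φ hz h]
  exact Φ.measurable_indicator_collisionalEnergyTransfer hG hGm hφc hφm h

/-- From the indicator form to a.e.-measurability under a law carried by the good set. [folklore] -/
theorem aemeasurable_of_measurable_indicator {β : Type*} [MeasurableSpace β] [Zero β]
    {W : Config N d X → β} (hW : Measurable (Φ.good.indicator W)) {μ : Measure (Config N d X)}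
    (hμ : μ Φ.goodᶜ = 0) : AEMeasurable W μ := by
  refine ⟨_, hW, ?_⟩
  have hae : ∀ᵐ z ∂μ, z ∈ Φ.good := by
    rw [ae_iff]
    exact hμ
  filter_upwards [hae] with z hz
  exact (indicator_of_mem hz W).symm

/-- A.e.-measurability of the collisional virial in the datum under every law carried by the
good set (e.g. the Liouville measure, Gibbs and local Gibbs laws). [folklore] -/
theorem aemeasurable_collisionalVirial [T2Space X] (hG : G.IsHardSphereRegular ε)
    (hGm : G.IsMeasurable) {φ : X → ℝ} (hφc : Continuous φ) (hφm : Measurable φ) (h : ℝ)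
    {μ : Measure (Config N d X)} (hμ : μ Φ.goodᶜ = 0) :
    AEMeasurable (fun z => Φ.collisionalVirial φ z h) μ :=
  Φ.aemeasurable_of_measurable_indicator (Φ.measurable_indicator_collisionalVirial hG hGm hφc hφm h) hμ

/-- A.e.-measurability of the collisional stress in the datum under every law carried by the
good set. [folklore] -/
theorem aemeasurable_collisionalStress [T2Space X] (hG : G.IsHardSphereRegular ε)
    (hGm : G.IsMeasurable) {A : X → EuclideanSpace ℝ d →L[ℝ] EuclideanSpace ℝ d}
    (hAc : Continuous A) (hAm : Measurable A) (h : ℝ) {μ : Measure (Config N d X)}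
    (hμ : μ Φ.goodᶜ = 0) : AEMeasurable (fun z => Φ.collisionalStress A z h) μ :=
  Φ.aemeasurable_of_measurable_indicator (Φ.measurable_indicator_collisionalStress hG hGm hAc hAm h) hμ

/-- A.e.-measurability of the collision-indexed momentum transfer in the datum under every law
carried by the good set. [folklore] -/
theorem aemeasurable_collisionalMomentumTransfer [T2Space X] (hG : G.IsHardSphereRegular ε)
    (hGm : G.IsMeasurable) {φ : X → EuclideanSpace ℝ d} (hφc : Continuous φ) (hφm : Measurable φ)
    (h : ℝ) {μ : Measure (Config N d X)} (hμ : μ Φ.goodᶜ = 0) :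
    AEMeasurable (fun z => Φ.collisionalMomentumTransfer φ z h) μ :=
  Φ.aemeasurable_of_measurable_indicator
    (Φ.measurable_indicator_collisionalMomentumTransfer hG hGm hφc hφm h) hμ

/-- A.e.-measurability of the collision-indexed energy transfer in the datum under every law
carried by the good set. [folklore] -/
theorem aemeasurable_collisionalEnergyTransfer [T2Space X] (hG : G.IsHardSphereRegular ε)
    (hGm : G.IsMeasurable) {φ : X → ℝ} (hφc : Continuous φ) (hφm : Measurable φ) (h : ℝ)
    {μ : Measure (Config N d X)} (hμ : μ Φ.goodᶜ = 0) :
    AEMeasurable (fun z => Φ.collisionalEnergyTransfer φ z h) μ :=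
  Φ.aemeasurable_of_measurable_indicator
    (Φ.measurable_indicator_collisionalEnergyTransfer hG hGm hφc hφm h) hμ

/-- A.e.-measurability of the (jump-form) collisional momentum transfer in the datum under every
law carried by the good set, continuous test field. [folklore] -/
theorem aemeasurable_momentumTransfer [T2Space X] (hG : G.IsHardSphereRegular ε)
    (hGm : G.IsMeasurable) {φ : X → EuclideanSpace ℝ d} (hφc : Continuous φ) (hφm : Measurable φ)
    (h : ℝ) {μ : Measure (Config N d X)} (hμ : μ Φ.goodᶜ = 0) :
    AEMeasurable (fun z => Φ.momentumTransfer φ z h) μ :=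
  Φ.aemeasurable_of_measurable_indicator (Φ.measurable_indicator_momentumTransfer hG hGm hφc hφm h) hμ

/-- A.e.-measurability of the (jump-form) collisional energy transfer in the datum under every
law carried by the good set, continuous test field. [folklore] -/
theorem aemeasurable_energyTransfer [T2Space X] (hG : G.IsHardSphereRegular ε)
    (hGm : G.IsMeasurable) {φ : X → ℝ} (hφc : Continuous φ) (hφm : Measurable φ) (h : ℝ)
    {μ : Measure (Config N d X)} (hμ : μ Φ.goodᶜ = 0) :
    AEMeasurable (fun z => Φ.energyTransfer φ z h) μ :=
  Φ.aemeasurable_of_measurable_indicator (Φ.measurable_indicator_energyTransfer hG hGm hφc hφm h) hμ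

end HardSphereFlow

end Flow

end Kinetic

/-! ## On the flat torus with `ε < 1/2`: continuous fields, no other side condition -/

section TorusGeometry

variable {d : Type*} [Fintype d] {N : ℕ} {ε : ℝ}

namespace HardSphereFlow

/-- On `T^d` with `ε < 1/2`, the collisional virial along the flow against a continuous scalar
field, extended by `0` off the good set, is measurable in the datum. [folklore] -/
theorem measurable_indicator_collisionalVirial_torus (Φ : HardSphereFlow (Torus.geometry d) ε N)
    (hε : ε < 2⁻¹) {φ : UnitAddTorus d → ℝ} (hφ : Continuous φ) (h : ℝ) :
    Measurable (Φ.good.indicator fun z => Φ.collisionalVirial φ z h) :=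
  Φ.measurable_indicator_collisionalVirial (Torus.isHardSphereRegular_geometry hε)
    Torus.isMeasurable_geometry hφ hφ.measurable h

/-- On `T^d` with `ε < 1/2`, the collisional stress along the flow against a continuous matrix
field, extended by `0` off the good set, is measurable in the datum. [folklore] -/
theorem measurable_indicator_collisionalStress_torus (Φ : HardSphereFlow (Torus.geometry d) ε N)
    (hε : ε < 2⁻¹) {A : UnitAddTorus d → EuclideanSpace ℝ d →L[ℝ] EuclideanSpace ℝ d}
    (hA : Continuous A) (h : ℝ) :
    Measurable (Φ.good.indicator fun z => Φ.collisionalStress A z h) :=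
  Φ.measurable_indicator_collisionalStress (Torus.isHardSphereRegular_geometry hε)
    Torus.isMeasurable_geometry hA hA.measurable h

/-- On `T^d` with `ε < 1/2`, the jump-form collisional momentum transfer
`Φ.momentumTransfer J z h` against a CONTINUOUS vector field, extended by `0` off the good set,
is measurable in the datum (the `C¹` case without the bound on `ε` is
`CollisionalTransferMeasurable`). [folklore] -/
theorem measurable_indicator_momentumTransfer_torus' (Φ : HardSphereFlow (Torus.geometry d) ε N)
    (hε : ε < 2⁻¹) {J : UnitAddTorus d → EuclideanSpace ℝ d} (hJ : Continuous J) (h : ℝ) :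
    Measurable (Φ.good.indicator fun z => Φ.momentumTransfer J z h) :=
  Φ.measurable_indicator_momentumTransfer (Torus.isHardSphereRegular_geometry hε)
    Torus.isMeasurable_geometry hJ hJ.measurable h

/-- On `T^d` with `ε < 1/2`, the jump-form collisional energy transfer `Φ.energyTransfer ϑ z h`
against a continuous scalar field, extended by `0` off the good set, is measurable in the datum.
[folklore] -/
theorem measurable_indicator_energyTransfer_torus' (Φ : HardSphereFlow (Torus.geometry d) ε N)
    (hε : ε < 2⁻¹) {ϑ : UnitAddTorus d → ℝ} (hϑ : Continuous ϑ) (h : ℝ) :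
    Measurable (Φ.good.indicator fun z => Φ.energyTransfer ϑ z h) :=
  Φ.measurable_indicator_energyTransfer (Torus.isHardSphereRegular_geometry hε)
    Torus.isMeasurable_geometry hϑ hϑ.measurable h

/-- On `T^d` with `ε < 1/2`, the collisional virial against a continuous field is a.e.-measurable
under every law carried by the good set. [folklore] -/
theorem aemeasurable_collisionalVirial_torus (Φ : HardSphereFlow (Torus.geometry d) ε N)
    (hε : ε < 2⁻¹) {φ : UnitAddTorus d → ℝ} (hφ : Continuous φ) (h : ℝ)
    {μ : Measure (Config N d (UnitAddTorus d))} (hμ : μ Φ.goodᶜ = 0) :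
    AEMeasurable (fun z => Φ.collisionalVirial φ z h) μ :=
  Φ.aemeasurable_of_measurable_indicator (Φ.measurable_indicator_collisionalVirial_torus hε hφ h) hμ

/-- On `T^d` with `ε < 1/2`, the jump-form momentum transfer against a continuous field is
a.e.-measurable under every law carried by the good set. [folklore] -/
theorem aemeasurable_momentumTransfer_torus' (Φ : HardSphereFlow (Torus.geometry d) ε N)
    (hε : ε < 2⁻¹) {J : UnitAddTorus d → EuclideanSpace ℝ d} (hJ : Continuous J) (h : ℝ)
    {μ : Measure (Config N d (UnitAddTorus d))} (hμ : μ Φ.goodᶜ = 0) :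
    AEMeasurable (fun z => Φ.momentumTransfer J z h) μ :=
  Φ.aemeasurable_of_measurable_indicator (Φ.measurable_indicator_momentumTransfer_torus' hε hJ h) hμ

/-- On `T^d` with `ε < 1/2`, the jump-form energy transfer against a continuous field is
a.e.-measurable under every law carried by the good set. [folklore] -/
theorem aemeasurable_energyTransfer_torus' (Φ : HardSphereFlow (Torus.geometry d) ε N)
    (hε : ε < 2⁻¹) {ϑ : UnitAddTorus d → ℝ} (hϑ : Continuous ϑ) (h : ℝ)
    {μ : Measure (Config N d (UnitAddTorus d))} (hμ : μ Φ.goodᶜ = 0) :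
    AEMeasurable (fun z => Φ.energyTransfer ϑ z h) μ :=
  Φ.aemeasurable_of_measurable_indicator (Φ.measurable_indicator_energyTransfer_torus' hε hϑ h) hμ

end HardSphereFlow

end TorusGeometry

end

end Literature.Analysis.FluidPDE
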